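import Mathlib
import HarnessLib
import HarnessLib.Audit
import Summits.AtomisticToContinuum.Statement
import Literature.MathematicalPhysics.QuantumManyBody.PeriodicBoseGas
import Literature.MathematicalPhysics.QuantumManyBody.PeriodicBoseGasFourier
import Summits.AtomisticToContinuum.BoseEinsteinCondensation.Theorems.BECSectorPoincareTwoScaleScatteringLengthFinite
import HarnessLib.Audit.Status.Attr

/-!
Route: BECSubharmonicContinuation

# Route BECSubharmonicContinuation — subharmonic coherence continuation — depletion is the Newtonian
potential of the kinetic coherence; a one-sided sign beyond the healing length carries coherence
from ξ to L

It suffices to show X = SubharmonicCoherence ∧ HealingScaleDeficit on the TORUS of side L =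
(N/ρ)^{1/3} (card
subharmonic-coherence-continuation, its S1 and S2 typed VOLUMETRICALLY, without spherical means,
Laplacians or positivity of γ).
Objects (units ħ = 2m = 1, ξ = (8πρa)^{-1/2}, a = scattering length of v): for a periodic trial
state Ψ and particle i,
G(y) := Re ∫_{cell^N} conj Ψ(X with x_i ↦ x_i + y)·Ψ(X) dX (translation-averaged one-body density
matrix, G(0) = 1,
n₀/N = L⁻³∫_cell G) and the KINETIC COHERENCE H(y) := Re Σ_k ∫_{cell^N} conj ∂_{i,k}Ψ(X with x_i ↦
x_i + y)·∂_{i,k}Ψ(X) dX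
= −ΔG(y) (gradient–gradient correlation; H(0) = T/N = t, ∫_cell H = 0, H positive-definite: N·H =
Σ_k |k|² n_k cos k·y).
SubharmonicCoherence (S1, the heart): ∃ M such that at all small ρ, for all large N and all
δ-near-minimisers,
(4π)⁻¹ ∫_{Mξ ≤ |y| ≤ L/2} H₊(y)/|y| dy ≤ 1/8 — the Newtonian potential at the origin of the POSITIVE
PART of the kinetic
coherence beyond M healing lengths is small: on spherical average the density matrix is (almost)
subharmonic outside the
healing ball. HealingScaleDeficit (S2, the payment): for every fixed M and ε, at small ρ and large
N, near-minimisers have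
translate-averaged cube-condensation deficit 1 − (Mξ)⁻³∫ Π_k(1 − |y_k|/Mξ)₊ G(y) dy ≤ ε (local
condensation at the healing
scale INSIDE the thermodynamic torus). Given X, the harmonic-minorant chain (supports
HarmonicMinorant, CoreDeficitBounds,
BallCriterion — all provable now) gives ⨍_{B_{L/2}} G ≥ 11/16 and n₀ ≥ (3/8)N, i.e. PeriodicBEC
(stmt-AtomisticToContinuum-8997 ≡ 0826 verbatim;
filed here as the line's Target node, kind crux since the 2026-08-16 DEFINITION OF A ROUTE: an open
problem may appear only as a crux),
and the shared BoundaryTransferWeak (stmt-0827) gives the Dirichlet conjunct. A second, cell-free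
door is
filed as crux CoreSubharmonicCoherence (the same sign statement from ONE healing length, paid by the
proved LSSY upper bound alone).
Lean: `SubharmonicCoherence ∧ HealingScaleDeficit`

## Assembly
Crux-only deciding theorem (glue.lean, rev 6): `theorem closes (hP : PeriodicBEC) (hB :
BoundaryTransferWeak) :
_root_.BoseEinsteinCondensation := fun v hv => hB v hv (hP v hv)` — the audited sub-problem
statement BY NAME (abbrev of the
Literature conjunct). The line reaches the crux PeriodicBEC through the support glue X → Target
filed by name:
ContinuationToPeriodicBEC : SubharmonicCoherence → HealingScaleDeficit → PeriodicBEC (main door; its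
proof is the harmonic-minorant
bookkeeping over the analytic supports HarmonicMinorant, CoreDeficitBounds(b), BallCriterion,
ScatteringLengthFinite, FreeGasCase and
the proved LSSY upper bound, c = 3/8) and CoreContinuation : CoreSubharmonicCoherence → PeriodicBEC
(cell-free door, CoreDeficitBounds(a),
c = 1/8) — plain-prover obligations; once ContinuationToPeriodicBEC_holds lands, `closes` can be
re-supplied over S1, S2 instead of hP.
The Assembly item displays the thesis chain SubharmonicCoherence → HealingScaleDeficit →
ContinuationToPeriodicBEC → BoundaryTransferWeak →
Statement (`:= fun h1 h2 h8 h9 => closes (h8 h1 h2) h9`).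

Rationale: WHY THIS LINE. Mechanism (potential theory of coherence): with u = 1 − G ≥ 0, Δu = H, the exact
ball-mean Green identity
1 − ⨍_{B_S} G = ∫_{B_S} H(y) K_S(|y|) dy, K_S(s) = (4π)⁻¹[1/s − 3/(2S) + s²/(2S³)] ∈ [0, 1/(4πs)],
says the coherence deficit of a
ball IS the (regularised Newtonian) potential at the origin of the neutral charge H; splitting at R
= Mξ, the core contributes
D(R) = (4π)⁻¹∫_{B_R}H/|y| = (1/N)Σ_k n_k(1 − cos|k|R) ≤ 8 × [translate-averaged cube deficit at side
R] (termwise: 1 − cos|u| ≤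
6(1 − Π sinc²(u_j/2)), verified here numerically, sup = 6 at u → 0) plus t·R³/S → 0, and the shell
contributes at most
(4π)⁻¹∫_{shell} H₊/|y| — so BEC costs exactly a healing-scale condensation statement (S2: the
GP-limit Poincaré mechanism of
LSSY2005 Lemma 5.2 + Lemma 4.1 / Fournais2020 / Junge2026 / ChongLiangNam2026, run in cells of side
Mξ of the TL torus, where
ℓ²·(excess energy per particle) = M²Y^{1/17}/8π → 0) and a ONE-SIDED SIGN of the far kinetic
coherence (S1), which every theory of
the 3-D superfluid predicts with margin (Bogoliubov: h̄ ∝ F(r/ξ), F < 0 for r > 2.8ξ, tail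
−c√(ρa³)/(ξr⁴) fixed by the sign of the
|k|-linear term n₀mc/2k of GavoretNozieres1964; Schwartz1977's +C/r² law for γ; numerics in §
Numbers); d = 3 enters as the
boundedness of the Newton kernel at infinity (in d = 2 the minorant A + B log r has no limit).
Imported area: Newtonian potential
theory / Gauss mean-value formulas (Bargmann1952-type reading: the condensate depletes by the
Bargmann integral of its own
coherence well), plus torus Fourier analysis for the supports; the continuation costs NOTHING in L,
which is what distinguishes
it from every gap/Poincaré localisation
(Literature.Barriers.AtomisticToContinuum.KineticGapLengthScales; ChongLiangNam2026 Thm 1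
bootstraps sub-cube condensation to a cube but pays ℓ⁻²). Versus the 34 open BEC routes: none
continues coherence radially from a
sign of Δγ̄; BECTorusUnfolding compares two tori, BECInfraredBound/BECGroundStateSOS/BECSectorGap
bound n_k mode by mode, the
landscape/Palm/swap routes bound one-particle conditional laws; the planner's typing removes the
card's positivity input
(γ ≥ 0) and its minorant sign slip (triage-14) by working with ball means and the Fourier side of
the constant mode
(BallCriterion: sup_{m≠0} 3j₁(π|m|)/(π|m|) = 3/π² < 1/2). Negatives index: empty at filing. (This
route re-files, conforming to D-0027 §2.1 — Assembly and `closes` conclude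
`_root_.BoseEinsteinCondensation` by name — the planner's own
route-AtomisticToContinuum-BECSubharmonicCoherence of 12:20Z, retired `not-a-thesis` by the 13:40Z
audit for concluding the Literature constant; statements unchanged.)

RANKED CRUXES. #0 PeriodicBEC (crux, rank 0; was the Target — re-badged 2026-08-16 under the
DEFINITION OF A ROUTE: an open problem may appear only as a crux, and it is the hypothesis of the
crux-only `closes`) — constant-mode BEC for δ-near-minimisers of the periodic N-body energy on the
torus of side (N/ρ)^{1/3} at all small densities — verbatim the signature of
BECPeriodicReduction.PeriodicBEC (stmt-AtomisticToContinuum-0826; shared item 8997, six routes);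
what X buys through ContinuationToPeriodicBEC (or CoreSubharmonicCoherence through
CoreContinuation). (why it might fail: It is thermodynamic-limit ground-state BEC on the torus —
open; every printed bound pays the kinetic gap L² (KineticGapLengthScales) and d = 3 is
infrared-marginal (BogoliubovPerturbationInfrared).) [LiebSeiringerSolovejYngvason2005,
Fournais2020, Junge2026, ChongLiangNam2026]
#2 SubharmonicCoherence (crux) — (card S1, volumetric form) for every repulsive finite-range v with
0 < a < ∞ there are M > 0 and ρ₀ > 0 such that for 0 < ρ < ρ₀, for all large N, there is δ > 0 with:
every δ-near-minimiser Ψ of the periodic energy on the torus of side L = (N/ρ)^{1/3} has (4π)⁻¹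
∫_{Mξ ≤ |y| ≤ L/2} (H_Ψ(i,y))₊/|y| dy ≤ 1/8 for every particle i, where H_Ψ(i,y) = Re Σ_k ∫_{cell^N}
conj ∂_{i,k}Ψ(X^{i→x_i+y}) ∂_{i,k}Ψ(X) dX = −Δ_y G_Ψ(i,y) and ξ = (8πρa)^{-1/2}: the spherically
averaged density matrix is subharmonic beyond M healing lengths up to a positive part of small
Newtonian potential (Bogoliubov value: 0 for M ≥ 3). [difficulty: open-problem] (why it might fail:
Signed, the shell integral is (1/N)Σn_k(cos|k|Mξ−cos|k|L/2): it fails iff k²n_k has a positive bump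
below 1/Mξ (n_k harder than ~k⁻³·log, quasi-long-range order, an L-dependent zero-mode
redistribution at |k|~2π/L) — nothing proved excludes this; it is the IR problem one-sided.)
[LiebSeiringerSolovejYngvason2005, GavoretNozieres1964, Schwartz1977, DysonLiebSimon1978,
KennedyLiebShastry1988, MoraCastin2003, PitaevskiiStringari1991,
Literature.Barriers.AtomisticToContinuum.BogoliubovPerturbationInfrared]
#3 HealingScaleDeficit (crux) — (card S2, translate-averaged window form) for every repulsive
finite-range v with 0 < a < ∞, every M > 0 and ε > 0 there is ρ₀ > 0 such that for 0 < ρ < ρ₀, for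
all large N, there is δ > 0 with: every δ-near-minimiser Ψ on the torus of side (N/ρ)^{1/3}
satisfies 1 − ε ≤ R⁻³ ∫ Π_k (1 − |y_k|/R)₊ G_Ψ(i,y) dy with R = Mξ — equivalently the
cube-condensation deficit of side Mξ, averaged over all translates of the cube, is ≤ ε (in Fourier:
(1/N)Σ_k n_k(1 − Π_j sinc²(k_jR/2)) ≤ ε). Local condensation at the healing scale inside the
THERMODYNAMIC torus; expected size C√(ρa³) for every fixed M. [difficulty: L] (why it might fail:
Lemma 4.1 in cells of side Mξ needs |Ω∩cell|^{2/3}, Ω = aY^{-5/17}-neighbourhood of the other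
particles: kinetic-energy-weighted local number fluctuations of TL near-minimisers (cells hold
~M³(ρa³)^{-1/2} particles) are unprinted at L=(N/ρ)^{1/3}; Junge2026/FournaisEtAl2024 stay
sub-thermodynamic.) [LiebSeiringerSolovejYngvason2005, Fournais2020, Junge2026, FournaisEtAl2024,
ChongLiangNam2026, Literature.Barriers.AtomisticToContinuum.KineticGapLengthScales]
#4 CoreSubharmonicCoherence (crux) — (the cell-free door; SubharmonicCoherence with M = 1) for every
repulsive finite-range v with 0 < a < ∞ there is ρ₀ > 0 such that for 0 < ρ < ρ₀, for all large N,
some δ > 0 and every δ-near-minimiser Ψ: (4π)⁻¹ ∫_{ξ ≤ |y| ≤ L/2} (H_Ψ(i,y))₊/|y| dy ≤ 1/8 for every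
i. With the PROVED LSSY upper bound (t ξ² ≤ ½(1 + C(ρa³)^{1/3})) the core is paid by energy alone
(D(ξ) ≤ tξ²/2 ≤ 9/32), so this crux + supports give PeriodicBEC with c = 1/8 and no cell input
(CoreContinuation). Bogoliubov value of the left side: (4/π)(a/ξ)∫_1^{2.8} sF₊ ds ≈ 0.31√(ρa³).
[deps: SubharmonicCoherence] [difficulty: open-problem] (why it might fail: Needs the SIZE of h̄₊ on
[ξ,3ξ] (Bogoliubov: O(a/ξ³), integrated 0.31√(ρa³)), not only the far sign: an O(1) relative
distortion of k²n_k at k~1/ξ (not excluded pointwise by LHY energy theorems) or any L-dependent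
positive bump beyond ξ of potential ≥1/8 kills it.) [LiebSeiringerSolovejYngvason2005,
GavoretNozieres1964, ReattoChester1967, FournaisSolovej2020, YauYin2009, Schwartz1977]
#5 BoundaryTransferWeak (crux) — (shared verbatim with route BECPeriodicReduction,
stmt-AtomisticToContinuum-0827) for each repulsive finite-range v, constant-mode BEC for periodic
near-minimisers at all small densities implies the conjunct's Dirichlet, mode-free HasGroundStateBEC
v ρ for all small ρ. [difficulty: L] (why it might fail: Dirichlet and periodic ground-state
energies differ by a wall term ≫ the near-minimiser slack N/L², so no energy-comparison proof;
Neumann bracketing must re-localise without re-importing the l⁻² gap; BEC is boundary-condition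
sensitive (Robinson, Lauwers–Verbeure–Zagrebnov).) [LiebSeiringerSolovejYngvason2005,
BoccatoSeiringer2023, Junge2026, LauwersVerbeureZagrebnov2003]
#9 FourierRepresentation (support) — for L > 0, every periodic trial state Ψ of N particles, every i
and y: N·G_Ψ(i,y) = Σ_{m∈ℤ³} n_m cos(2πm·y/L) and N·H_Ψ(i,y) = Σ_m (2π/L)²|m|² n_m cos(2πm·y/L) as
convergent sums (HasSum), n_m = cellOccupation of the normalised plane wave L^{-3/2} e^{2πim·x/L}.
Proof: polarised Parseval on the first particle (HilbertBasis.hasSum_inner_mul_inner /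
hasSum_sq_cellFourierCoeff, cellFourierCoeff_fderiv of PeriodicBoseGasFourier.lean), Bose symmetry
to move slot i to slot 1, Fubini over the other particles with non-negative terms; Σ_m n_m = N and
Σ_m |k_m|² n_m = N·t < ∞ give absolute convergence. The foundation of the three analytic supports
below. [difficulty: M] [Fournais2020, LiebSeiringerSolovejYngvason2005]
#9 BallCriterion (support) — for L > 0 and any periodic trial state: if the mean of G_Ψ(i,·) over
the ball B(0, L/2) is ≥ σ then condensateOccupation ≥ (2σ − 1)N. Proof via FourierRepresentation:
⨍_{B_{L/2}} cos(k_m·y) dy = ω(π|m|), ω(x) = 3(sin x − x cos x)/x³ ≤ 3(1+x)/x³ ≤ 0.41 < 1/2 for x ≥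
π, so σ ≤ (n₀ + ½(N − n₀))/N; n₀ = cellOccupation of the m = 0 wave = condensateOccupation
(cellWave_zero). No positivity of γ needed (sharp value sup_{m≠0} ω(π|m|) = 3/π² ≈ 0.304).
[difficulty: provable-now] [PenroseOnsager1956, LiebSeiringerSolovejYngvason2005]
#9 HarmonicMinorant (support) — (the continuation lemma, volumetric) for L > 0, any periodic trial
state, any i and 0 < R ≤ S: 1 − ⨍_{B(0,S)} G ≤ (4π)⁻¹∫_{B(0,R)} H(y)/|y| dy + H(0)·R³/S +
(4π)⁻¹∫_{R≤|y|≤S} H₊(y)/|y| dy. Proof: per mode 1 − ω(|k|S) = ∫_{B_S} |k|² cos(k·y) K_S(|y|) dy with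
K_S(s) = (4π)⁻¹[1/s − 3/(2S) + s²/(2S³)] (Gauss ball-mean formula for Δu = H; verified numerically
here), sum with weights n_m/N (FourierRepresentation, Fubini: K_S ∈ L¹); on the shell 0 ≤ K_S ≤
1/(4π|y|); on the core |K_S − 1/(4π|y|)| ≤ 3/(8πS) and |H| ≤ H(0) (Cauchy–Schwarz) give the middle
term (even R³/(2S)). Valid for every S (wrapped balls included). [difficulty: M] [Bargmann1952,
GilbargTrudinger2001, LiebSeiringerSolovejYngvason2005]
#9 CoreDeficitBounds (support) — for L > 0, any periodic trial state, any i and R > 0, the core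
potential D(R) := (4π)⁻¹∫_{B(0,R)} H(y)/|y| dy satisfies (a) D(R) ≤ H(0)·R²/2 and (b) D(R) ≤ 8·(1 −
R⁻³∫ Π_k(1 − |y_k|/R)₊ G(y) dy). Proof via FourierRepresentation: (4π)⁻¹∫_{B_R}|k|²cos(k·y)/|y| dy =
1 − cos(|k|R) and R⁻³∫Π(1−|y_k|/R)₊cos(k·y)dy = Π_j sinc²(k_jR/2) (Fejér), so D(R) = (1/N)Σ n_m(1 −
cos|k_m|R); then 1 − cos x ≤ x²/2, resp. the three-variable inequality 1 − cos|u| ≤ 6(1 − Π_j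
sinc²(u_j/2)) for all u ∈ ℝ³ (equality to second order at u = 0 with positive quartic margin
Σu_j⁴/40 + Σ_{i<j}u_i²u_j²/24; numerically max ratio 5.93 for |u| ≥ ½; constant 8 filed for slack)
and Σ_m n_m = N. [difficulty: M] [LiebSeiringerSolovejYngvason2005, Fournais2020]
#9 FreeGasCase (support) — the degenerate case a = 0: for admissible v with scatteringLength v = 0
the PeriodicBEC body holds (c = 1/2). Proof: LSSY2005_upperBound_periodic_holds with a = 0 gives
E₀^per(N,L) = 0 for N ≥ 2, 2R₀ < L; a δ-near-minimiser then has kinetic energy ≤ δ, and the proved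
torus Poincaré inequality (LSSY2005_lemma41_periodic_holds with Ω = K) applied to each slice x_i ↦ Ψ
gives N − n₀ ≤ C L² δ; take δ = N/(2CL²). [difficulty: provable-now]
[LiebSeiringerSolovejYngvason2005, Fournais2020]
#9 ScatteringLengthFinite (support) — (shared verbatim with route EqualScatteringTransfer,
stmt-AtomisticToContinuum-0851) finite range ⇒ scatteringLength v ≠ ⊤ (a ≤ R₀ + ε by the C¹ trial φ
= 0 on B_{R₀}, = 1 off B_{R₀+ε}; hard cores included since ⊤·0 = 0). Discharges the `≠ ⊤` hypothesis
of the cruxes in the glue. [difficulty: provable-now] [LiebSeiringerSolovejYngvason2005]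
#9 ContinuationToPeriodicBEC (support, stmt-14585; route-choice repair 2026-08-16) — GLUE X → Target
by name: SubharmonicCoherence → HealingScaleDeficit → PeriodicBEC. Proof (uses the analytic supports
as LEMMAS — their landed theorems — not as hypotheses): `unfold PeriodicBEC`; fix v; a ≠ ⊤
(ScatteringLengthFinite); a = 0 ⇒ FreeGasCase; else M, ρ₁ from S1, ρ₂ from S2 at (M, ε = 1/64), C, c
from LSSY2005_upperBound_periodic_holds; for ρ < min ρ's and N large (2R₀ < L, N ≥ 2, 2tM³ξ³/L ≤
1/16 where t = H(i,0) = T/N ≤ (E₀^per + 1)/N ≤ 4πρa(1 + Cc′) + 1/N by Bose symmetry and kinetic ≤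
periodicEnergy), δ = min(δ₁, δ₂, 1): HarmonicMinorant at R = Mξ, S = L/2 with CoreDeficitBounds(b)
gives 1 − ⨍_{B_{L/2}}G ≤ 8/64 + 1/16 + 1/8 = 5/16, and BallCriterion gives n₀ ≥ (3/8)N. [difficulty:
M] [LiebSeiringerSolovejYngvason2005, Fournais2020]
#9 CoreContinuation (support, stmt-14570) — GLUE of the cell-free door by name:
CoreSubharmonicCoherence → PeriodicBEC. Proof: as above with R = ξ, S = L/2 and
CoreDeficitBounds(a): D(ξ) ≤ tξ²/2 ≤ ¼(1 + C(ρa³)^{1/3}) + δξ²/(2N) ≤ 9/32 for ρ < ρ₀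
(LSSY2005_upperBound_periodic_holds: E₀^per/N ≤ 4πρ₁a(1 + 12a/b), ρ₁ < ρ, ξ² = 1/(8πρa)), middle
term 2tξ³/L ≤ 1/32 for N large, shell ≤ 1/8: 1 − ⨍G ≤ 7/16, hence n₀ ≥ N/8. [difficulty: M]
[LiebSeiringerSolovejYngvason2005]
(Render note for planners: the gate emits supports sorted by item id AS STRING, so a newly added
support (id 14xxx) is placed BEFORE the 9xxx supports — a new support may name only the
target/cruxes or lower-sorting items, never HarmonicMinorant & co. by name; that is why both glue
items name cruxes only.)

TWO-LAYER PLAN. HealingScaleDeficit ⇐ MomentumLocalisation → LocalNumberControl →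
HealingScaleDeficit (MomentumLocalisation: for near-minimisers the
translate-averaged cell variance is ≤ C[R²·T_out/N + E(|Ω∩cell|^{2/3}·kinetic)/N] by
LSSY2005_lemma41_holds cell by cell, T_out ≤
CρaN(Y^{1/17}+Y^{1/3}) + 2δ by LSSY2005_lemma52_periodic_holds and the proved upper bound;
LocalNumberControl: kinetic-weighted local
particle numbers in cubes of side 3Mξ are ≤ K·ρ(3Mξ)³ up to a negligible tail). SubharmonicCoherence
⇐ FarSign → NearField →
SubharmonicCoherence (FarSign: h̄ ≤ 0 on [M′ξ, L/2] from a Gauss-law/monotone-flux argument Q(r) =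
∫_{B_r}H non-increasing, or bridge
decorrelation of the end-forces of the split boson; NearField: the potential of h̄₊ on [Mξ, M′ξ] is
≤ 1/8 by healing-scale (second-order
energy) control); OR the single-sign-change variant (h̄ changes sign once) which with
HealingScaleDeficit already suffices.
CoreSubharmonicCoherence ⇐ same children with M = 1. BoundaryTransferWeak: as planned in
BECPeriodicReduction (Neumann bracketing + a
mode-free criterion). k ≤ 3, depth 1; nothing filed now.

KILL CRITERIA. ¬SubharmonicCoherence for some admissible v at arbitrarily small ρ (for EVERY M a
positive bump of the spherical kinetic coherence beyond
Mξ with Newtonian potential > 1/8 at arbitrarily large N) closes the route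
`refuted:SubharmonicCoherence` — and, since the signed shell
integral is a lower bound for the infrared occupation, it would exhibit n_k harder than k⁻³: a
signal to every BEC route. If the witness
is only the CONSTANT (potential of h̄₊ between 1/8 and, say, 1/2 at fixed M), REPAIR by restating
with threshold η and window ball
B(0,L) (BallCriterion constant 0.035 instead of 0.304) — one restate, not a new route.
¬CoreSubharmonicCoherence alone (bump on [ξ,3ξ])
just drops rank 4 (`--drop`, the main door stands). ¬HealingScaleDeficit at fixed M would contradict
LSSY Thm 5.1-type local
condensation inside the TL state — closes the route and flags
BECScaleChaining/BECVortexSheetDuality's healing-scale inputs.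
¬BoundaryTransferWeak kills this route and BECPeriodicReduction/BECTorusUnfolding, not the conjunct.
PeriodicBEC (0826) proved
elsewhere moots ranks 2–4 (close `superseded`).

NOT DECOMPOSED YET. How to prove the sign (bridge/half-ghost decorrelation E_{B_r}[Δ_xΨ₀/Ψ₀] ≥ −κ,
maximum principle for the enclosed charge Q(r), or
single-sign-change of h̄ = ∫k²n_k sinc) — layer-2 children of SubharmonicCoherence after
HealingScaleDeficit lands; the local-number
lemma inside HealingScaleDeficit; the sharp window constant (3/π² vs the filed 1/2) and the sharp
weight constant (6 vs the filed 8);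
the card's positivity/Perron–Frobenius input and near-minimiser rigidity (NOT needed in this typing:
every statement is about
δ-near-minimisers and the window step is Fourier-side); the d = 2 log-minorant variant; the card's
'pure' Delsarte/LP constant c*(3)
(retired companion delsarte-cone-coherence-charge) — superseded here by CoreSubharmonicCoherence,
whose core is paid by 1 − cos x ≤ x²/2;
any rate in N or value of c beyond 3/8.

CHEAPEST FALSIFIER. Bogoliubov level (run here, python, pure quadrature): h(r) = (4/π)(a/ξ³)F(r/ξ),
F(s) = π/(8s) + ∫₀^∞(x⁴v_x² − ¼)sinc(xs)dx: F(1) = 0.0879,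
F(2) = 0.0073, F(2.5) = 0.00142, F(2.75) = 2.3e−4, F(3) = −4.2e−4, F(4) = −8.9e−4, F(10) = −6.4e−5
(sign change at r₀ ≈ 2.8ξ, tail → −r⁻⁴);
predicted left sides: S1 with M = 3: 0; CoreSubharmonicCoherence (M = 1): 0.061·a/ξ = 0.31√(ρa³)
(0.01 at ρa³ = 10⁻³) against the
threshold 1/8 — room (ρa³)^{-1/2}. The refuter's cheapest kill is therefore FINITE-SIZE, not
Bogoliubov: second-order number-conserving
finite-torus Bogoliubov (MoraCastin2003) or PIGS/VMC at ρa³ ∈ [10⁻⁴, 10⁻²], L/ξ ∈ [6, 30]: measure H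
(two-point correlation of the
gradient/kinetic estimator) and report (4π)⁻¹∫_{Mξ<|y|<L/2} H₊/|y| for M = 1, 3 as L grows — any
growth with L kills S1. Analytic kill:
a positive translation-invariant trial family with energy E₀ + o(gap) and a superharmonic γ̄ tail
(fragmented cats have h̄ ≈ +2/(rℓ) but
energy E₀ + O(N/ℓ²) above the δ of the cruxes, so they do not qualify).

NUMBERS. ξ = (8πρa)^{-1/2}; tξ² ≤ ½(1 + 12·a/b), a/b = (4π/3)^{1/3}(ρa³)^{1/3} (LSSY2005 Thm 2.2,
PROVED in tree: LSSY2005_upperBound_periodic_holds);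
Fournais2020_condensation, LSSY2005_lemma52_periodic, LSSY2005_lemma41(_periodic),
LSSY2005_thm51_periodic all PROVED in tree (cone facts
the supports and HealingScaleDeficit rest on). Window constants: sup_{m≠0} 3j₁(π|m|)/(π|m|) = 3/π² =
0.3040 (|m| = 1; next 0.0348 at
|m|² = 8), filed bound ½ via 3(1+π)/π³ = 0.4007; ball B(0,L): 0.0348. Weight inequality: sup_u (1 −
cos|u|)/(1 − Πsinc²(u_j/2)) = 6
(u → 0), 5.93 on |u| ≥ ½ (random search 6×10⁵ points + local refinement); filed 8. Kernel: K_S(s) =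
(4π)⁻¹[1/s − 3/(2S) + s²/(2S³)],
check ⨍_{B_S}|y|² = 3S²/5 ✓, per-mode identity 1 − ω(kS) = k²∫₀^S s² sinc(ks)·4πK_S(s)ds verified to
1e−11 at five (k,S). Main-door
arithmetic: ε = 1/64, η = 1/8, o(1) ≤ 1/16 ⇒ 1 − ⨍G ≤ 5/16 ⇒ n₀ ≥ 3N/8; cell-free door: 9/32 + 1/32
+ 1/8 = 7/16 ⇒ n₀ ≥ N/8.
Bogoliubov depletion (8/3√π)√(ρa³); Def_{Mξ} ≤ depletion for every R. Items at open: 14 (4 cruxes, 1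
target, 8 supports, 1 assembly).

DEFINITION REQUESTS. None. Everything is inlined (closed `let`s G, H, ξ, pw at the head of each
decl) over
Literature.MathematicalPhysics.QuantumManyBody.BoseGas.{PeriodicTrialState, cellN, periodicEnergy,
periodicGroundStateEnergy, sideLength,
scatteringLength, IsRepulsiveFiniteRange, condensateOccupation, cellOccupation, cellWave,
HasGroundStateBEC, BoseEinsteinCondensation}
(lean search --decl: all present; Sketch.lean rc 0 with the Assembly term proof). A convenience
notion `translationCorrelation` /
`gradientCorrelation N L Ψ i y` in PeriodicBoseGas.lean would shorten every signature of this route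
and of BECTorusUnfolding (same G);
not requested now to avoid signature churn on shared items.

Novelty: Searches (2026-08-15, this seat): `lit search --hybrid "mean value subharmonic one-particle density
matrix Bose condensate kinetic energy
correlation Laplacian"` (12 textbook rows: Pethick–Smith, Griffin–Snoke–Stringari, LSSY pp.116,35 —
nothing closer); `lit galaxy search
--star all` ×3 ("spherical mean of the one-body density matrix", "density matrix is subharmonic",
"local condensation implies global
condensation": 0, 0, 0 rows); `lit search --source crossref "off-diagonal long-range order large
distance behavior one-body density matrix
interacting Bose ground state momentum distribution"` (15: Schwartz 1977 Schwartz1977, Stringari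
JLTP 1991, Girardeau 1965
— sum-rule/large-r laws, no potential theory); `lit frontier AtomisticToContinuum --since 2022` (BEC
descendants arXiv:2510.20493
ChongLiangNam2026, arXiv:2603.20776 Junge2026 — read pp.2–3 of the former: multiscale Poincaré
bootstrap paying ℓ⁻², "does not cover the
thermodynamic limit"); `lit bridges AtomisticToContinuum --cross any` (no Bose bridge); plus the
card's ideator searches and refuter
audit-12 (galaxy 'one-body density matrix is subharmonic' 0; zbMATH 0; crossref → Schwartz1977)
whose finds are adopted.
Nearest prior art found: LiebSeiringerSolovejYngvason2005 Ch. 5 / Thm 5.1 (GLOBAL Poincaré at the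
box scale = the catalogued barrier,
proved in tree as LSSY2005_thm51_periodic_holds); ChongLiangNam2026 = arXiv:2510.20493 Thm 1
(local-to-global condensation by a
Poincaré inequality for cubes, cost ℓ⁻²); Junge2  [refs: 2510.20493, 2603.20776, Schwartz1977, ChongLiangNam2026, Junge2026, LiebSeiringerSolovejYngvason2005, Fournais2020, DysonLiebSimon1978, KennedyLiebShastry1988]

Barriers (technique_class: coherence-potential-theory, harmonic-minorant, local-BEC): - technique_class: coherence-potential-theory, harmonic-minorant, local-BEC
- Literature.Barriers.AtomisticToContinuum.KineticGapLengthScales: evaded as declared — the only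
Poincaré-type inequalities used live at scale ≤ Mξ (HealingScaleDeficit, inside the proved window:
ℓ²·excess = M²Y^{1/17}/8π → 0) or are the trivial 1 − cos x ≤ x²/2 at scale ξ (cell-free door);
propagation from Mξ to L/2 is the harmonic minorant, which costs nothing in L; the barrier returns
only if a prover attacks SubharmonicCoherence by a box-scale gap.
- Literature.Barriers.AtomisticToContinuum.KineticGapLengthScalesNarrow: APPLIES to the
energy-window half and is respected — HealingScaleDeficit IS an energy-window statement, but at cell
scale ℓ = Mξ where ρaℓ²·ε(Y) = M²Y^{1/17}/8π ≲ 1 sits inside the proved two-sided ceiling (LSSY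
Lemma 5.2 precision suffices; box/Neumann localisation itself is not blocked); the step Mξ → L is
NOT 'depletion ≤ gap⁻¹ × excess' but the harmonic minorant under SubharmonicCoherence, a statement
about δ-near-minimisers with δ quantified AFTER N (δ < 4π²N/L² intended): the Galilei-boost /
phase-modulation witnesses e^{±2πim·Σx_j/L}Φ₀, e^{±itΣsin}Φ₀ lie ≥ 4π²|m|²N/L² above E₀, do not
qualify, and would violate S1 grossly (H acquires +|k_m|²cos(k_m·y)G, shell potential ≈ π²/4 ≫ 1/8)
— so S1 can only be proved through the file's exits (a) minimality / eigenvalue equation, (b)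
positivity Ψ₀ > 0 with the repulsion (the card's bridge / half-ghost reading: genuinely 3-D input,
th

Novelty grade: new-combination — refuter rreview-0815T13-7-0 (route-review seat; grade CARRIED from card audits 12/28 of subharmonic-coherence-continuation; no new search by this seat): [Riesz/Newton potential theory of the positive-definite one-body density matrix: depletion = Newtonian potential at 0 of H = -Lap G, harmonic-minor (refuter refuter-rreview-0815T13-7-0, 2026-08-15T14:18:01Z; prior: LSSY2005 Ch.5 Thm 5.1 (global Poincare, barrier KineticGapLengthScales); Fournais 2020 arXiv:2011.00309 Thm 1.2; FGJMO 2024 arXiv:2408.14222 Thm 1.3; Junge 2026 arXiv:2603.20776 Cor. 6; Chong-Liang-Nam 2026 arXiv:2510.20493 Thm 1; Schwartz 1977; Bargmann 1952)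

History (route lifecycle, newest last):
- 2026-08-16T03:08:27Z · rev 4: restated ContinuationToPeriodicBEC (stmt-AtomisticToContinuum-9007) — route-choice (a) target-unreachable repair: restate glue ContinuationToPeriodicBEC (stmt-9007) 1:1 so its conclusion is the Target decl `PeriodicBEC` BY NAME in (planner-rchoice-AtomisticToContinuum-BECSubhar-8d8792dd-0)
- 2026-08-16T03:34:18Z · rev 4: restated ContinuationToPeriodicBEC (stmt-AtomisticToContinuum-14220) — route-choice (a), step 2 (makes rev 4 renderable): the by-name glue stmt-14220 named the 9xxx supports, which the gate renders AFTER it (supports sorted by id a (planner-rchoice-AtomisticToContinuum-BECSubhar-8d8792dd-0)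
- 2026-08-16T03:57:22Z · rev 4: restated CoreContinuation (stmt-AtomisticToContinuum-9008) — route-choice (a), step 3 (second door): restate glue CoreContinuation (stmt-9008) as `CoreSubharmonicCoherence → PeriodicBEC` — Target BY NAME, naming only the (planner-rchoice-AtomisticToContinuum-BECSubhar-8d8792dd-0)
- 2026-08-16T04:10:58Z · rev 7: restated Assembly (stmt-AtomisticToContinuum-9009) — tidy after the route-choice / crux-only repairs (revs 4–6): (i) restate the optional Assembly item (stmt-9009, whose chain still listed the five analytic suppor (planner-rchoice-AtomisticToContinuum-BECSubhar-8d8792dd-0)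
- 2026-08-25T02:38:07Z · DORMANT — reconciler: no traction for 7.3 d (last activity item-evidence-added at 2026-08-17T18:55:01Z); parked, not closed — `ledger route dormant route-AtomisticToConti (operator:999:3497423)
- 2026-08-29T03:28:56Z · REACTIVATED — reconciler: reactivated — activity statement-checked at 2026-08-29T01:17:37Z after parking at 2026-08-25T02:38:07Z (operator:999:291428)

sub-problem: BoseEinsteinCondensation · status: open · opened planner-plancard-AtomisticToContinuum-BoseEin-931ddc28-0 2026-08-15T13:46:35Z · rev 7 · ledger route-AtomisticToContinuum-BECSubharmonicContinuation
GENERATED by the gate from the ledger (D-0016/17). Provers cite these decls: `theorem foo : Summit.AtomisticToContinuum.BoseEinsteinCondensation.Theses.BECSubharmonicContinuation.<Decl> := …` in Summits/AtomisticToContinuum/BoseEinsteinCondensation/Theorems/<Name>.lean.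
-/

namespace Summit.AtomisticToContinuum.BoseEinsteinCondensation.Theses.BECSubharmonicContinuation

open scoped BigOperators Topology Manifold Classical MeasureTheory ProbabilityTheory Matrix InnerProductSpace ComplexConjugate ContinuousMap
open Filter Set Function TopologicalSpace MeasureTheory

attribute [summit_statement] _root_.BoseEinsteinCondensation

/-- item stmt-AtomisticToContinuum-8997 · crux · rank 0 · open · by planner
why it might fail: It is thermodynamic-limit ground-state BEC on the torus — the open problem (LSSY Ch.5 (5.2)); every printed bound pays the kinetic gap ∝L² and stops at boxes ≲ a(ρa³)^{-3/4-η} (Fournais2020 Thm 1.2, Junge2026 Cor 6, ChongLiangNam2026: κ<2/11, 2/7−); T=0 Bogoliubov theory is IR-marginal in d=3.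
sources: LiebSeiringerSolovejYngvason2005, Fournais2020, Junge2026, ChongLiangNam2026, arXiv:2209.11714, Literature.MathematicalPhysics.QuantumManyBody.BoseGas.Fournais2020_condensation
[target] constant-mode BEC for δ-near-minimisers of the periodic N-body energy on the torus of side
(N/ρ)^{1/3} at all small densities — verbatim the signature of BECPeriodicReduction.PeriodicBEC
(stmt-AtomisticToContinuum-0826); what X buys through ContinuationToPeriodicBEC (or
CoreSubharmonicCoherence through CoreContinuation). -/
@[route_item "route-AtomisticToContinuum-BECSubharmonicContinuation", crux]
def PeriodicBEC : Prop :=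
  ∀ v : ℝ → ENNReal, Literature.MathematicalPhysics.QuantumManyBody.BoseGas.IsRepulsiveFiniteRange v → ∃ ρ₀ : ℝ, 0 < ρ₀ ∧ ∀ ρ : ℝ, 0 < ρ → ρ < ρ₀ → ∃ c : ℝ, 0 < c ∧ ∀ᶠ N : ℕ in Filter.atTop, ∃ δ : ENNReal, 0 < δ ∧ ∀ Ψ : Literature.MathematicalPhysics.QuantumManyBody.BoseGas.PeriodicTrialState N (Literature.MathematicalPhysics.QuantumManyBody.BoseGas.sideLength ρ N), Literature.MathematicalPhysics.QuantumManyBody.BoseGas.periodicEnergy v Ψ ≤ Literature.MathematicalPhysics.QuantumManyBody.BoseGas.periodicGroundStateEnergy v N (Literature.MathematicalPhysics.QuantumManyBody.BoseGas.sideLength ρ N) + δ → ENNReal.ofReal (c * N) ≤ Literature.MathematicalPhysics.QuantumManyBody.BoseGas.condensateOccupation N (Literature.MathematicalPhysics.QuantumManyBody.BoseGas.sideLength ρ N) Ψ.ψ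

/-- item stmt-AtomisticToContinuum-8998 · crux · rank 2 · open · by planner
why it might fail: Signed shell = (1/N)Σn_k(cos|k|Mξ−cos|k|L/2): its positive part tops 1/8 if TL near-minimisers put >N/16 into the modes |k|=2π/L, if k²n_k has a positive IR bump below 1/(Mξ) (n_k ≳ k⁻³ grows it like log L), or if H sign-oscillates past Mξ — only ENERGY is controlled, no IR bound on n_k exists.
sources: LiebSeiringerSolovejYngvason2005, GavoretNozieres1964, Schwartz1977, ChongLiangNam2026, Junge2026, MoraCastin2003
[crux] (card S1, volumetric form) for every repulsive finite-range v with 0 < a < ∞ there are M > 0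
and ρ₀ > 0 such that for 0 < ρ < ρ₀, for all large N, there is δ > 0 with: every δ-near-minimiser Ψ
of the periodic energy on the torus of side L = (N/ρ)^{1/3} has (4π)⁻¹ ∫_{Mξ ≤ |y| ≤ L/2}
(H_Ψ(i,y))₊/|y| dy ≤ 1/8 for every particle i, where H_Ψ(i,y) = Re Σ_k ∫_{cell^N} conj
∂_{i,k}Ψ(X^{i→x_i+y}) ∂_{i,k}Ψ(X) dX = −Δ_y G_Ψ(i,y) and ξ = (8πρa)^{-1/2}: the spherically averaged
density matrix is subharmonic beyond M healing lengths up to a positive part of small Newtonian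
potential (Bogoliubov value: 0 for M ≥ 3). [difficulty: open-problem] -/
@[route_item "route-AtomisticToContinuum-BECSubharmonicContinuation"]
def SubharmonicCoherence : Prop :=
  let H : (N : ℕ) → (L : ℝ) → Literature.MathematicalPhysics.QuantumManyBody.BoseGas.PeriodicTrialState N L → Fin N → EuclideanSpace ℝ (Fin 3) → ℝ := fun N L Ψ i y => (∑ k : Fin 3, ∫ X in Literature.MathematicalPhysics.QuantumManyBody.BoseGas.cellN N L, conj (fderiv ℝ Ψ.ψ (Function.update X i (X i + y)) (Pi.single i (EuclideanSpace.single k (1 : ℝ)))) * fderiv ℝ Ψ.ψ X (Pi.single i (EuclideanSpace.single k (1 : ℝ)))).re; let ξ : (ℝ → ENNReal) → ℝ → ℝ := fun v ρ => (Real.sqrt (8 * Real.pi * ρ * (Literature.MathematicalPhysics.QuantumManyBody.BoseGas.scatteringLength v).toReal))⁻¹; ∀ v : ℝ → ENNReal, Literature.MathematicalPhysics.QuantumManyBody.BoseGas.IsRepulsiveFiniteRange v → Literature.MathematicalPhysics.QuantumManyBody.BoseGas.scatteringLength v ≠ ⊤ → 0 < Literature.MathematicalPhysics.QuantumManyBody.BoseGas.scatteringLength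 v → ∃ M : ℝ, 0 < M ∧ ∃ ρ₀ : ℝ, 0 < ρ₀ ∧ ∀ ρ : ℝ, 0 < ρ → ρ < ρ₀ → ∀ᶠ N : ℕ in Filter.atTop, ∃ δ : ENNReal, 0 < δ ∧ ∀ Ψ : Literature.MathematicalPhysics.QuantumManyBody.BoseGas.PeriodicTrialState N (Literature.MathematicalPhysics.QuantumManyBody.BoseGas.sideLength ρ N), Literature.MathematicalPhysics.QuantumManyBody.BoseGas.periodicEnergy v Ψ ≤ Literature.MathematicalPhysics.QuantumManyBody.BoseGas.periodicGroundStateEnergy v N (Literature.MathematicalPhysics.QuantumManyBody.BoseGas.sideLength ρ N) + δ → ∀ i : Fin N, (4 * Real.pi)⁻¹ * (∫ y in {y : EuclideanSpace ℝ (Fin 3) | M * ξ v ρ ≤ ‖y‖ ∧ ‖y‖ ≤ Literature.MathematicalPhysics.QuantumManyBody.BoseGas.sideLength ρ N / 2}, max (H N (Literature.MathematicalPhysics.QuantumManyBody.BoseGas.sideLength ρ N) Ψ i y) 0 / ‖y‖) ≤ 1 / 8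

/-- item stmt-AtomisticToContinuum-8999 · crux · rank 3 · open · by planner
why it might fail: Energy alone (LSSY Thm 2.2) gives deficit ≤ tM²ξ²/12 ≈ M²/24, so the content is ε ≪ M²/24 (glue: ε=1/64 at M≈3): Lemmas 5.2+4.1 must run in cells of side Mξ INSIDE the TL torus, whose |Ω∩cell|^{2/3} term needs kinetic-weighted local number control of TL near-minimisers — unprinted.
sources: LiebSeiringerSolovejYngvason2005, FournaisSolovej2020, Fournais2020, Junge2026, FournaisEtAl2024, ChongLiangNam2026
[crux] (card S2, translate-averaged window form) for every repulsive finite-range v with 0 < a < ∞,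
every M > 0 and ε > 0 there is ρ₀ > 0 such that for 0 < ρ < ρ₀, for all large N, there is δ > 0
with: every δ-near-minimiser Ψ on the torus of side (N/ρ)^{1/3} satisfies 1 − ε ≤ R⁻³ ∫ Π_k (1 −
|y_k|/R)₊ G_Ψ(i,y) dy with R = Mξ — equivalently the cube-condensation deficit of side Mξ, averaged
over all translates of the cube, is ≤ ε (in Fourier: (1/N)Σ_k n_k(1 − Π_j sinc²(k_jR/2)) ≤ ε). Local
condensation at the healing scale inside the THERMODYNAMIC torus; expected size C√(ρa³) for every
fixed M. [difficulty: L] -/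
@[route_item "route-AtomisticToContinuum-BECSubharmonicContinuation"]
def HealingScaleDeficit : Prop :=
  let G : (N : ℕ) → (L : ℝ) → Literature.MathematicalPhysics.QuantumManyBody.BoseGas.PeriodicTrialState N L → Fin N → EuclideanSpace ℝ (Fin 3) → ℝ := fun N L Ψ i y => (∫ X in Literature.MathematicalPhysics.QuantumManyBody.BoseGas.cellN N L, conj (Ψ.ψ (Function.update X i (X i + y))) * Ψ.ψ X).re; let ξ : (ℝ → ENNReal) → ℝ → ℝ := fun v ρ => (Real.sqrt (8 * Real.pi * ρ * (Literature.MathematicalPhysics.QuantumManyBody.BoseGas.scatteringLength v).toReal))⁻¹; ∀ v : ℝ → ENNReal, Literature.MathematicalPhysics.QuantumManyBody.BoseGas.IsRepulsiveFiniteRange v → Literature.MathematicalPhysics.QuantumManyBody.BoseGas.scatteringLength v ≠ ⊤ → 0 < Literature.MathematicalPhysics.QuantumManyBody.BoseGas.scatteringLength v → ∀ M : ℝ, 0 < M → ∀ ε : ℝ, 0 < ε → ∃ ρ₀ : ℝ, 0 < ρ₀ ∧ ∀ ρ : ℝ, 0 < ρ → ρ < ρ₀ → ∀ᶠ N : ℕ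 in Filter.atTop, ∃ δ : ENNReal, 0 < δ ∧ ∀ Ψ : Literature.MathematicalPhysics.QuantumManyBody.BoseGas.PeriodicTrialState N (Literature.MathematicalPhysics.QuantumManyBody.BoseGas.sideLength ρ N), Literature.MathematicalPhysics.QuantumManyBody.BoseGas.periodicEnergy v Ψ ≤ Literature.MathematicalPhysics.QuantumManyBody.BoseGas.periodicGroundStateEnergy v N (Literature.MathematicalPhysics.QuantumManyBody.BoseGas.sideLength ρ N) + δ → ∀ i : Fin N, 1 - ε ≤ (M * ξ v ρ)⁻¹ ^ 3 * ∫ y : EuclideanSpace ℝ (Fin 3), (∏ k : Fin 3, max (1 - |y k| / (M * ξ v ρ)) 0) * G N (Literature.MathematicalPhysics.QuantumManyBody.BoseGas.sideLength ρ N) Ψ i y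

/-- item stmt-AtomisticToContinuum-9000 · crux · rank 4 · open · by planner
why it might fail: Bogoliubov already has H₊>0 on [ξ,2.8ξ], so M=1 needs the SIZE ≈0.31√(ρa³) of the near-field potential below 1/8, i.e. O(1)-relative pointwise control of k²n_k at k~1/ξ for TL near-minimisers — beyond every LHY-order energy theorem; an O(1) distortion there or an L-dependent bump kills it.
sources: LiebSeiringerSolovejYngvason2005, GavoretNozieres1964, ReattoChester1967, FournaisSolovej2020, YauYin2009, BastiCenatiempoSchlein2021
[crux] (the cell-free door; SubharmonicCoherence with M = 1) for every repulsive finite-range v with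
0 < a < ∞ there is ρ₀ > 0 such that for 0 < ρ < ρ₀, for all large N, some δ > 0 and every
δ-near-minimiser Ψ: (4π)⁻¹ ∫_{ξ ≤ |y| ≤ L/2} (H_Ψ(i,y))₊/|y| dy ≤ 1/8 for every i. With the PROVED
LSSY upper bound (t ξ² ≤ ½(1 + C(ρa³)^{1/3})) the core is paid by energy alone (D(ξ) ≤ tξ²/2 ≤
9/32), so this crux + supports give PeriodicBEC with c = 1/8 and no cell input (CoreContinuation).
Bogoliubov value of the left side: (4/π)(a/ξ)∫_1^{2.8} sF₊ ds ≈ 0.31√(ρa³). [deps: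
SubharmonicCoherence] [difficulty: open-problem] -/
@[route_item "route-AtomisticToContinuum-BECSubharmonicContinuation"]
def CoreSubharmonicCoherence : Prop :=
  let H : (N : ℕ) → (L : ℝ) → Literature.MathematicalPhysics.QuantumManyBody.BoseGas.PeriodicTrialState N L → Fin N → EuclideanSpace ℝ (Fin 3) → ℝ := fun N L Ψ i y => (∑ k : Fin 3, ∫ X in Literature.MathematicalPhysics.QuantumManyBody.BoseGas.cellN N L, conj (fderiv ℝ Ψ.ψ (Function.update X i (X i + y)) (Pi.single i (EuclideanSpace.single k (1 : ℝ)))) * fderiv ℝ Ψ.ψ X (Pi.single i (EuclideanSpace.single k (1 : ℝ)))).re; let ξ : (ℝ → ENNReal) → ℝ → ℝ := fun v ρ => (Real.sqrt (8 * Real.pi * ρ * (Literature.MathematicalPhysics.QuantumManyBody.BoseGas.scatteringLength v).toReal))⁻¹; ∀ v : ℝ → ENNReal, Literature.MathematicalPhysics.QuantumManyBody.BoseGas.IsRepulsiveFiniteRange v → Literature.MathematicalPhysics.QuantumManyBody.BoseGas.scatteringLength v ≠ ⊤ → 0 < Literature.MathematicalPhysics.QuantumManyBody.BoseGas.scatteringLength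 v → ∃ ρ₀ : ℝ, 0 < ρ₀ ∧ ∀ ρ : ℝ, 0 < ρ → ρ < ρ₀ → ∀ᶠ N : ℕ in Filter.atTop, ∃ δ : ENNReal, 0 < δ ∧ ∀ Ψ : Literature.MathematicalPhysics.QuantumManyBody.BoseGas.PeriodicTrialState N (Literature.MathematicalPhysics.QuantumManyBody.BoseGas.sideLength ρ N), Literature.MathematicalPhysics.QuantumManyBody.BoseGas.periodicEnergy v Ψ ≤ Literature.MathematicalPhysics.QuantumManyBody.BoseGas.periodicGroundStateEnergy v N (Literature.MathematicalPhysics.QuantumManyBody.BoseGas.sideLength ρ N) + δ → ∀ i : Fin N, (4 * Real.pi)⁻¹ * (∫ y in {y : EuclideanSpace ℝ (Fin 3) | ξ v ρ ≤ ‖y‖ ∧ ‖y‖ ≤ Literature.MathematicalPhysics.QuantumManyBody.BoseGas.sideLength ρ N / 2}, max (H N (Literature.MathematicalPhysics.QuantumManyBody.BoseGas.sideLength ρ N) Ψ i y) 0 / ‖y‖) ≤ 1 / 8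

/-- item stmt-AtomisticToContinuum-0827 · crux · rank 5 · open · by planner
why it might fail: δ(N)-near-minimisers of the PERIODIC problem only, δ ≪ wall energy ~ρ²aξL² between Dirichlet and periodic ground states: the Dirichlet GS never qualifies, interior restrictions are neither periodic nor sharp-N ⇒ no energy proof; Neumann bracketing must dodge the ℓ⁻² gap; only ENERGY is BC-free.
sources: LiebSeiringerSolovejYngvason2005, Literature.MathematicalPhysics.QuantumManyBody.BoseGas.LSSY2005_e0_periodic_eq_dirichlet_offCritical, Junge2026, BoccatoSeiringer2023, Basti2022, LauwersVerbeureZagrebnov2003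
[crux] BoundaryTransferWeak (mode-free boundary-condition transfer, per potential): for each
repulsive finite-range v, PeriodicBEC(v) implies ∃ρ₀>0 ∀ρ∈(0,ρ₀) HasGroundStateBEC v ρ (Dirichlet
ground state, λ_max(γ) ≥ cN via condensateNumber). Not glue: near-minimiser slacks are O(N/L²) while
Dirichlet/periodic energies differ by a boundary term ≫ N/L², so no energy-comparison proof;
expected route: Neumann bracketing of interior sub-boxes (−Δ_Dir ≥ ⊕−Δ_Neu, v ≥ 0) + a mode-free
criterion (λ_max ≥ tr γ²/N). Only the ENERGY analogue is in print (LiebSeiringerSolovejYngvason2005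
Ch. 2 after (2.8)). v ≡ 0: hypothesis and conclusion both true. -/
@[route_item "route-AtomisticToContinuum-BECSubharmonicContinuation", crux]
def BoundaryTransferWeak : Prop :=
  ∀ v : ℝ → ENNReal, Literature.MathematicalPhysics.QuantumManyBody.BoseGas.IsRepulsiveFiniteRange v → (∃ ρ₀ : ℝ, 0 < ρ₀ ∧ ∀ ρ : ℝ, 0 < ρ → ρ < ρ₀ → ∃ c : ℝ, 0 < c ∧ ∀ᶠ N : ℕ in Filter.atTop, ∃ δ : ENNReal, 0 < δ ∧ ∀ Ψ : Literature.MathematicalPhysics.QuantumManyBody.BoseGas.PeriodicTrialState N (Literature.MathematicalPhysics.QuantumManyBody.BoseGas.sideLength ρ N), Literature.MathematicalPhysics.QuantumManyBody.BoseGas.periodicEnergy v Ψ ≤ Literature.MathematicalPhysics.QuantumManyBody.BoseGas.periodicGroundStateEnergy v N (Literature.MathematicalPhysics.QuantumManyBody.BoseGas.sideLength ρ N) + δ → ENNReal.ofReal (c * N) ≤ Literature.MathematicalPhysics.QuantumManyBody.BoseGas.condensateOccupation N (Literature.MathematicalPhysics.QuantumManyBody.BoseGas.sideLength ρ N) Ψ.ψ)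 → ∃ ρ₀ : ℝ, 0 < ρ₀ ∧ ∀ ρ : ℝ, 0 < ρ → ρ < ρ₀ → Literature.MathematicalPhysics.QuantumManyBody.BoseGas.HasGroundStateBEC v ρ

-- earlier CoreContinuation (stmt-AtomisticToContinuum-9008, replaced 2026-08-16T03:57:22Z -> stmt-AtomisticToContinuum-14570): retired by None — CoreSubharmonicCoherence → HarmonicMinorant → CoreDeficitBounds → BallCriterion → ScatteringLengthFinite → FreeGasCase → ∀ v : ℝ → ENNReal, Literature.MathematicalPhysics.QuantumManyBody.BoseGas.IsRepulsiveFiniteRange v → ∃ ρ₀ : ℝ, 0 < ρ₀ ∧ ∀ ρ : ℝ, 0 < ρ →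
/-- item stmt-AtomisticToContinuum-14570 · support · rank 9 · closed · proved by Summit.AtomisticToContinuum.BoseEinsteinCondensation.Theorems.CoreContinuationKernel.coreContinuation_proof @ 1e9875a371d1 (prover) · by planner
sources: LiebSeiringerSolovejYngvason2005
[support] GLUE of the cell-free door (route-choice repair 2026-08-16, option (a)):
CoreSubharmonicCoherence → PeriodicBEC, the Target concluded BY NAME, so crux rank 4 alone also
yields the Target (and, with BoundaryTransferWeak, the Statement: Mirror `closes_core`). Proof USES
the analytic supports as lemmas (HarmonicMinorant stmt-9003, CoreDeficitBounds stmt-9004(a),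
BallCriterion stmt-9002, ScatteringLengthFinite stmt-9006, FreeGasCase stmt-9005) and the in-tree
PROVED LSSY2005_upperBound_periodic_holds: `unfold PeriodicBEC`; R = ξ, S = L/2: D(ξ) ≤ tξ²/2 ≤ ¼(1
+ C(ρa³)^{1/3}) + δξ²/(2N) ≤ 9/32 for ρ < ρ₀ (E₀^per/N ≤ 4πρ₁a(1 + 12a/b), ρ₁ < ρ, ξ² = 1/(8πρa)),
middle term 2tξ³/L ≤ 1/32 for N large, shell ≤ 1/8 (the crux): 1 − ⨍G ≤ 7/16, hence n₀ ≥ N/8 by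
BallCriterion, i.e. PeriodicBEC with c = 1/8. [difficulty: M] -/
@[route_item "route-AtomisticToContinuum-BECSubharmonicContinuation"]
def CoreContinuation : Prop :=
  CoreSubharmonicCoherence → PeriodicBEC

-- `CoreContinuation` holds: proved by `Summit.AtomisticToContinuum.BoseEinsteinCondensation.Theorems.CoreContinuationKernel.coreContinuation_proof` @ 1e9875a371d1 (its module imports this route file, so no `_holds` link can be stated here).

-- earlier ContinuationToPeriodicBEC (stmt-AtomisticToContinuum-14220, replaced 2026-08-16T03:34:18Z -> stmt-AtomisticToContinuum-14585): retired by None — SubharmonicCoherence → HealingScaleDeficit → HarmonicMinorant → CoreDeficitBounds → BallCriterion → ScatteringLengthFinite → FreeGasCase → PeriodicBEC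
-- earlier ContinuationToPeriodicBEC (stmt-AtomisticToContinuum-9007, replaced 2026-08-16T03:08:27Z -> stmt-AtomisticToContinuum-14220): retired by None — SubharmonicCoherence → HealingScaleDeficit → HarmonicMinorant → CoreDeficitBounds → BallCriterion → ScatteringLengthFinite → FreeGasCase → ∀ v : ℝ → ENNReal, Literature.MathematicalPhysics.QuantumManyBody.BoseGas.IsRepulsiveFiniteRange v → ∃ ρ₀ : ℝ
/-- item stmt-AtomisticToContinuum-14585 · support · rank 9 · closed · proved by Summit.AtomisticToContinuum.BoseEinsteinCondensation.Theorems.continuationToPeriodicBEC_proof @ c5e20ac60d3f (prover) · by planner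
sources: LiebSeiringerSolovejYngvason2005, Fournais2020
[support] GLUE X → Target (main door; route-choice repair 2026-08-16, option (a) `Crux… →
PeriodicBEC`): SubharmonicCoherence → HealingScaleDeficit → PeriodicBEC, the Target concluded BY
NAME. Not pure logic any more — its proof is the harmonic-minorant bookkeeping that USES the five
analytic supports of this route as lemmas (cite their landed theorems / `_holds`: HarmonicMinorant
stmt-9003, CoreDeficitBounds stmt-9004(b), BallCriterion stmt-9002, ScatteringLengthFinite
stmt-9006, FreeGasCase stmt-9005) plus ONE in-tree proved energy fact
(LSSY2005_upperBound_periodic_holds). Proof: `unfold PeriodicBEC`; fix v; a ≠ ⊤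
(ScatteringLengthFinite); a = 0 ⇒ FreeGasCase; else M, ρ₁ from S1, ρ₂ from S2 at (M, ε = 1/64), C, c
from LSSY2005_upperBound_periodic_holds; for ρ < min ρ's and N large (2R₀ < L, N ≥ 2, 2tM³ξ³/L ≤
1/16 where t = H(i,0) = T/N ≤ (E₀^per + 1)/N ≤ 4πρa(1 + Cc′) + 1/N by Bose symmetry and kinetic ≤
periodicEnergy), δ = min(δ₁, δ₂, 1): HarmonicMinorant at R = Mξ, S = L/2 with CoreDeficitBounds(b)
gives 1 − ⨍_{B_{L/2}}G ≤ 8/64 + 1/16 + 1/8 = 5/16, and BallCriterion gives n₀ ≥ (3/8)N, i.e. the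
PeriodicBEC clause with c = 3/8. (The earlier 7-antecedent form listing the support -/
@[route_item "route-AtomisticToContinuum-BECSubharmonicContinuation"]
def ContinuationToPeriodicBEC : Prop :=
  SubharmonicCoherence → HealingScaleDeficit → PeriodicBEC

-- `ContinuationToPeriodicBEC` holds: proved by `Summit.AtomisticToContinuum.BoseEinsteinCondensation.Theorems.continuationToPeriodicBEC_proof` @ c5e20ac60d3f (its module imports this route file, so no `_holds` link can be stated here).

/-- item stmt-AtomisticToContinuum-9001 · support · rank 9 · closed · proved by Summit.AtomisticToContinuum.BoseEinsteinCondensation.Theorems.fourierRepresentation_proof (prover) · by planner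
sources: Fournais2020, LiebSeiringerSolovejYngvason2005
[support] for L > 0, every periodic trial state Ψ of N particles, every i and y: N·G_Ψ(i,y) =
Σ_{m∈ℤ³} n_m cos(2πm·y/L) and N·H_Ψ(i,y) = Σ_m (2π/L)²|m|² n_m cos(2πm·y/L) as convergent sums
(HasSum), n_m = cellOccupation of the normalised plane wave L^{-3/2} e^{2πim·x/L}. Proof: polarised
Parseval on the first particle (HilbertBasis.hasSum_inner_mul_inner / hasSum_sq_cellFourierCoeff,
cellFourierCoeff_fderiv of PeriodicBoseGasFourier.lean), Bose symmetry to move slot i to slot 1,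
Fubini over the other particles with non-negative terms; Σ_m n_m = N and Σ_m |k_m|² n_m = N·t < ∞
give absolute convergence. The foundation of the three analytic supports below. [difficulty: M] -/
@[route_item "route-AtomisticToContinuum-BECSubharmonicContinuation"]
def FourierRepresentation : Prop :=
  let G : (N : ℕ) → (L : ℝ) → Literature.MathematicalPhysics.QuantumManyBody.BoseGas.PeriodicTrialState N L → Fin N → EuclideanSpace ℝ (Fin 3) → ℝ := fun N L Ψ i y => (∫ X in Literature.MathematicalPhysics.QuantumManyBody.BoseGas.cellN N L, conj (Ψ.ψ (Function.update X i (X i + y))) * Ψ.ψ X).re; let H : (N : ℕ) → (L : ℝ) → Literature.MathematicalPhysics.QuantumManyBody.BoseGas.PeriodicTrialState N L → Fin N → EuclideanSpace ℝ (Fin 3) → ℝ := fun N L Ψ i y => (∑ k : Fin 3, ∫ X in Literature.MathematicalPhysics.QuantumManyBody.BoseGas.cellN N L, conj (fderiv ℝ Ψ.ψ (Function.update X i (X i + y)) (Pi.single i (EuclideanSpace.single k (1 : ℝ)))) * fderiv ℝ Ψ.ψ X (Pi.single i (EuclideanSpace.single k (1 : ℝ)))).re; let pw : ℝ → (Fin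 3 → ℤ) → EuclideanSpace ℝ (Fin 3) → ℂ := fun L m x => ((Real.sqrt (L ^ 3))⁻¹ : ℂ) * Literature.MathematicalPhysics.QuantumManyBody.BoseGas.cellWave L m x; ∀ (N : ℕ) (L : ℝ), 0 < L → ∀ (Ψ : Literature.MathematicalPhysics.QuantumManyBody.BoseGas.PeriodicTrialState N L) (i : Fin N) (y : EuclideanSpace ℝ (Fin 3)), HasSum (fun m : Fin 3 → ℤ => (Literature.MathematicalPhysics.QuantumManyBody.BoseGas.cellOccupation N L (pw L m) Ψ.ψ).toReal * Real.cos (2 * Real.pi * (∑ k : Fin 3, (m k : ℝ) * y k) / L)) ((N : ℝ) * G N L Ψ i y) ∧ HasSum (fun m : Fin 3 → ℤ => (2 * Real.pi / L) ^ 2 * (∑ k : Fin 3, (m k : ℝ) ^ 2) * (Literature.MathematicalPhysics.QuantumManyBody.BoseGas.cellOccupation N L (pw L m) Ψ.ψ).toReal * Real.cos (2 * Real.pi * (∑ k : Fin 3, (m k : ℝ) * y k) / L)) ((N : ℝ) * H N L Ψ i y)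

-- `FourierRepresentation` holds: proved by `Summit.AtomisticToContinuum.BoseEinsteinCondensation.Theorems.fourierRepresentation_proof` (its module imports this route file, so no `_holds` link can be stated here).

/-- item stmt-AtomisticToContinuum-9002 · support · rank 9 · closed · proved by Summit.AtomisticToContinuum.BoseEinsteinCondensation.Theorems.ballCriterion_proof @ adb35102f991 (prover) · by planner
sources: PenroseOnsager1956, LiebSeiringerSolovejYngvason2005
[support] for L > 0 and any periodic trial state: if the mean of G_Ψ(i,·) over the ball B(0, L/2) is
≥ σ then condensateOccupation ≥ (2σ − 1)N. Proof via FourierRepresentation: ⨍_{B_{L/2}} cos(k_m·y)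
dy = ω(π|m|), ω(x) = 3(sin x − x cos x)/x³ ≤ 3(1+x)/x³ ≤ 0.41 < 1/2 for x ≥ π, so σ ≤ (n₀ + ½(N −
n₀))/N; n₀ = cellOccupation of the m = 0 wave = condensateOccupation (cellWave_zero). No positivity
of γ needed (sharp value sup_{m≠0} ω(π|m|) = 3/π² ≈ 0.304). [difficulty: provable-now] -/
@[route_item "route-AtomisticToContinuum-BECSubharmonicContinuation"]
def BallCriterion : Prop :=
  let G : (N : ℕ) → (L : ℝ) → Literature.MathematicalPhysics.QuantumManyBody.BoseGas.PeriodicTrialState N L → Fin N → EuclideanSpace ℝ (Fin 3) → ℝ := fun N L Ψ i y => (∫ X in Literature.MathematicalPhysics.QuantumManyBody.BoseGas.cellN N L, conj (Ψ.ψ (Function.update X i (X i + y))) * Ψ.ψ X).re; ∀ (N : ℕ) (L σ : ℝ), 0 < L → ∀ (Ψ : Literature.MathematicalPhysics.QuantumManyBody.BoseGas.PeriodicTrialState N L) (i : Fin N), σ ≤ (⨍ y in Metric.ball (0 : EuclideanSpace ℝ (Fin 3)) (L / 2), G N L Ψ i y) → ENNReal.ofReal ((2 * σ - 1) * N) ≤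 Literature.MathematicalPhysics.QuantumManyBody.BoseGas.condensateOccupation N L Ψ.ψ

-- `BallCriterion` holds: proved by `Summit.AtomisticToContinuum.BoseEinsteinCondensation.Theorems.ballCriterion_proof` @ adb35102f991 (its module imports this route file, so no `_holds` link can be stated here).

/-- item stmt-AtomisticToContinuum-9003 · support · rank 9 · open · by planner
sources: Bargmann1952, GilbargTrudinger2001, LiebSeiringerSolovejYngvason2005
[support] (the continuation lemma, volumetric) for L > 0, any periodic trial state, any i and 0 < R
≤ S: 1 − ⨍_{B(0,S)} G ≤ (4π)⁻¹∫_{B(0,R)} H(y)/|y| dy + H(0)·R³/S + (4π)⁻¹∫_{R≤|y|≤S} H₊(y)/|y| dy.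
Proof: per mode 1 − ω(|k|S) = ∫_{B_S} |k|² cos(k·y) K_S(|y|) dy with K_S(s) = (4π)⁻¹[1/s − 3/(2S) +
s²/(2S³)] (Gauss ball-mean formula for Δu = H; verified numerically here), sum with weights n_m/N
(FourierRepresentation, Fubini: K_S ∈ L¹); on the shell 0 ≤ K_S ≤ 1/(4π|y|); on the core |K_S −
1/(4π|y|)| ≤ 3/(8πS) and |H| ≤ H(0) (Cauchy–Schwarz) give the middle term (even R³/(2S)). Valid for
every S (wrapped balls included). [difficulty: M] -/
@[route_item "route-AtomisticToContinuum-BECSubharmonicContinuation"]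
def HarmonicMinorant : Prop :=
  let G : (N : ℕ) → (L : ℝ) → Literature.MathematicalPhysics.QuantumManyBody.BoseGas.PeriodicTrialState N L → Fin N → EuclideanSpace ℝ (Fin 3) → ℝ := fun N L Ψ i y => (∫ X in Literature.MathematicalPhysics.QuantumManyBody.BoseGas.cellN N L, conj (Ψ.ψ (Function.update X i (X i + y))) * Ψ.ψ X).re; let H : (N : ℕ) → (L : ℝ) → Literature.MathematicalPhysics.QuantumManyBody.BoseGas.PeriodicTrialState N L → Fin N → EuclideanSpace ℝ (Fin 3) → ℝ := fun N L Ψ i y => (∑ k : Fin 3, ∫ X in Literature.MathematicalPhysics.QuantumManyBody.BoseGas.cellN N L, conj (fderiv ℝ Ψ.ψ (Function.update X i (X i + y)) (Pi.single i (EuclideanSpace.single k (1 : ℝ)))) * fderiv ℝ Ψ.ψ X (Pi.single i (EuclideanSpace.single k (1 : ℝ)))).re; ∀ (N : ℕ) (L : ℝ), 0 < L → ∀ (Ψ : Literature.MathematicalPhysics.QuantumManyBody.BoseGas.PeriodicTrialState N L) (i : Fin N) (R S : ℝ), 0 < R → R ≤ S → 1 - (⨍ y in Metric.ball (0 : EuclideanSpace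 ℝ (Fin 3)) S, G N L Ψ i y) ≤ (4 * Real.pi)⁻¹ * (∫ y in Metric.ball (0 : EuclideanSpace ℝ (Fin 3)) R, H N L Ψ i y / ‖y‖) + H N L Ψ i 0 * R ^ 3 / S + (4 * Real.pi)⁻¹ * (∫ y in {y : EuclideanSpace ℝ (Fin 3) | R ≤ ‖y‖ ∧ ‖y‖ ≤ S}, max (H N L Ψ i y) 0 / ‖y‖)

/-- item stmt-AtomisticToContinuum-9004 · support · rank 9 · closed · proved by Summit.AtomisticToContinuum.BoseEinsteinCondensation.Theorems.CoreDeficitBounds_proof (prover) · by planner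
sources: LiebSeiringerSolovejYngvason2005, Fournais2020
[support] for L > 0, any periodic trial state, any i and R > 0, the core potential D(R) :=
(4π)⁻¹∫_{B(0,R)} H(y)/|y| dy satisfies (a) D(R) ≤ H(0)·R²/2 and (b) D(R) ≤ 8·(1 − R⁻³∫ Π_k(1 −
|y_k|/R)₊ G(y) dy). Proof via FourierRepresentation: (4π)⁻¹∫_{B_R}|k|²cos(k·y)/|y| dy = 1 −
cos(|k|R) and R⁻³∫Π(1−|y_k|/R)₊cos(k·y)dy = Π_j sinc²(k_jR/2) (Fejér), so D(R) = (1/N)Σ n_m(1 −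
cos|k_m|R); then 1 − cos x ≤ x²/2, resp. the three-variable inequality 1 − cos|u| ≤ 6(1 − Π_j
sinc²(u_j/2)) for all u ∈ ℝ³ (equality to second order at u = 0 with positive quartic margin
Σu_j⁴/40 + Σ_{i<j}u_i²u_j²/24; numerically max ratio 5.93 for |u| ≥ ½; constant 8 filed for slack)
and Σ_m n_m = N. [difficulty: M] -/
@[route_item "route-AtomisticToContinuum-BECSubharmonicContinuation"]
def CoreDeficitBounds : Prop :=
  let G : (N : ℕ) → (L : ℝ) → Literature.MathematicalPhysics.QuantumManyBody.BoseGas.PeriodicTrialState N L → Fin N → EuclideanSpace ℝ (Fin 3) → ℝ := fun N L Ψ i y => (∫ X in Literature.MathematicalPhysics.QuantumManyBody.BoseGas.cellN N L, conj (Ψ.ψ (Function.update X i (X i + y))) * Ψ.ψ X).re; let H : (N : ℕ) → (L : ℝ) → Literature.MathematicalPhysics.QuantumManyBody.BoseGas.PeriodicTrialState N L → Fin N → EuclideanSpace ℝ (Fin 3) → ℝ := fun N L Ψ i y => (∑ k : Fin 3, ∫ X in Literature.MathematicalPhysics.QuantumManyBody.BoseGas.cellN N L, conj (fderiv ℝ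 Ψ.ψ (Function.update X i (X i + y)) (Pi.single i (EuclideanSpace.single k (1 : ℝ)))) * fderiv ℝ Ψ.ψ X (Pi.single i (EuclideanSpace.single k (1 : ℝ)))).re; ∀ (N : ℕ) (L : ℝ), 0 < L → ∀ (Ψ : Literature.MathematicalPhysics.QuantumManyBody.BoseGas.PeriodicTrialState N L) (i : Fin N) (R : ℝ), 0 < R → (4 * Real.pi)⁻¹ * (∫ y in Metric.ball (0 : EuclideanSpace ℝ (Fin 3)) R, H N L Ψ i y / ‖y‖) ≤ H N L Ψ i 0 * R ^ 2 / 2 ∧ (4 * Real.pi)⁻¹ * (∫ y in Metric.ball (0 : EuclideanSpace ℝ (Fin 3)) R, H N L Ψ i y / ‖y‖) ≤ 8 * (1 - R⁻¹ ^ 3 * ∫ y : EuclideanSpace ℝ (Fin 3), (∏ k : Fin 3, max (1 - |y k| / R) 0) * G N L Ψ i y)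

-- `CoreDeficitBounds` holds: proved by `Summit.AtomisticToContinuum.BoseEinsteinCondensation.Theorems.CoreDeficitBounds_proof` (its module imports this route file, so no `_holds` link can be stated here).

/-- item stmt-AtomisticToContinuum-9005 · support · rank 9 · closed · proved by Summit.AtomisticToContinuum.BoseEinsteinCondensation.Theorems.freeGasCase_proof (prover) · by planner
sources: LiebSeiringerSolovejYngvason2005, Fournais2020
[support] the degenerate case a = 0: for admissible v with scatteringLength v = 0 the PeriodicBEC
body holds (c = 1/2). Proof: LSSY2005_upperBound_periodic_holds with a = 0 gives E₀^per(N,L) = 0 for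
N ≥ 2, 2R₀ < L; a δ-near-minimiser then has kinetic energy ≤ δ, and the proved torus Poincaré
inequality (LSSY2005_lemma41_periodic_holds with Ω = K) applied to each slice x_i ↦ Ψ gives N − n₀ ≤
C L² δ; take δ = N/(2CL²). [difficulty: provable-now] -/
@[route_item "route-AtomisticToContinuum-BECSubharmonicContinuation"]
def FreeGasCase : Prop :=
  ∀ v : ℝ → ENNReal, Literature.MathematicalPhysics.QuantumManyBody.BoseGas.IsRepulsiveFiniteRange v → Literature.MathematicalPhysics.QuantumManyBody.BoseGas.scatteringLength v = 0 → ∃ ρ₀ : ℝ, 0 < ρ₀ ∧ ∀ ρ : ℝ, 0 < ρ → ρ < ρ₀ → ∃ c : ℝ, 0 < c ∧ ∀ᶠ N : ℕ in Filter.atTop, ∃ δ : ENNReal, 0 < δ ∧ ∀ Ψ : Literature.MathematicalPhysics.QuantumManyBody.BoseGas.PeriodicTrialState N (Literature.MathematicalPhysics.QuantumManyBody.BoseGas.sideLength ρ N), Literature.MathematicalPhysics.QuantumManyBody.BoseGas.periodicEnergy v Ψ ≤ Literature.MathematicalPhysics.QuantumManyBody.BoseGas.periodicGroundStateEnergy v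 N (Literature.MathematicalPhysics.QuantumManyBody.BoseGas.sideLength ρ N) + δ → ENNReal.ofReal (c * N) ≤ Literature.MathematicalPhysics.QuantumManyBody.BoseGas.condensateOccupation N (Literature.MathematicalPhysics.QuantumManyBody.BoseGas.sideLength ρ N) Ψ.ψ

-- `FreeGasCase` holds: proved by `Summit.AtomisticToContinuum.BoseEinsteinCondensation.Theorems.freeGasCase_proof` (its module imports this route file, so no `_holds` link can be stated here).

/-- item stmt-AtomisticToContinuum-9006 · support · rank 9 · closed · proved by Summit.AtomisticToContinuum.BoseEinsteinCondensation.Theorems.scatteringLengthFinite_proof @ a500d4b93471 (prover) · by planner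
sources: LiebSeiringerSolovejYngvason2005
[support] (shared verbatim with route EqualScatteringTransfer, stmt-AtomisticToContinuum-0851)
finite range ⇒ scatteringLength v ≠ ⊤ (a ≤ R₀ + ε by the C¹ trial φ = 0 on B_{R₀}, = 1 off B_{R₀+ε};
hard cores included since ⊤·0 = 0). Discharges the `≠ ⊤` hypothesis of the cruxes in the glue.
[difficulty: provable-now] -/
@[route_item "route-AtomisticToContinuum-BECSubharmonicContinuation"]
def ScatteringLengthFinite : Prop :=
  ∀ v : ℝ → ENNReal, Literature.MathematicalPhysics.QuantumManyBody.BoseGas.IsRepulsiveFiniteRange v → Literature.MathematicalPhysics.QuantumManyBody.BoseGas.scatteringLength v ≠ ⊤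

/-- `ScatteringLengthFinite` holds: proved by `Summit.AtomisticToContinuum.BoseEinsteinCondensation.Theorems.scatteringLengthFinite_proof` @ a500d4b93471. -/
theorem ScatteringLengthFinite_holds : ScatteringLengthFinite := _root_.Summit.AtomisticToContinuum.BoseEinsteinCondensation.Theorems.scatteringLengthFinite_proof

-- earlier Assembly (stmt-AtomisticToContinuum-9009, replaced 2026-08-16T04:10:58Z -> stmt-AtomisticToContinuum-14639): retired by None — SubharmonicCoherence → HealingScaleDeficit → HarmonicMinorant → CoreDeficitBounds → BallCriterion → ScatteringLengthFinite → FreeGasCase → ContinuationToPeriodicBEC → BoundaryTransferWeak → _root_.BoseEinsteinCondensation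
/-- item stmt-AtomisticToContinuum-14639 · assembly · rank 1 · closed · proved by Summit.AtomisticToContinuum.BoseEinsteinCondensation.Theorems.becSubharmonicContinuation_assembly_proof (prover) · by planner
sources: LiebSeiringerSolovejYngvason2005, PenroseOnsager1956
[assembly] SubharmonicCoherence → HealingScaleDeficit → ContinuationToPeriodicBEC →
BoundaryTransferWeak → BoseEinsteinCondensation (the sub-problem Statement decl
`_root_.BoseEinsteinCondensation`, by name) — literally the type of the deciding theorem `closes`
after the route-choice repair of 2026-08-16 (X = S1 ∧ S2 → Target PeriodicBEC by the glue, Target →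
Statement by the boundary transfer); `example : Assembly := closes`. -/
@[route_item "route-AtomisticToContinuum-BECSubharmonicContinuation"]
def Assembly : Prop :=
  SubharmonicCoherence → HealingScaleDeficit → ContinuationToPeriodicBEC → BoundaryTransferWeak → _root_.BoseEinsteinCondensation

-- `Assembly` holds: proved by `Summit.AtomisticToContinuum.BoseEinsteinCondensation.Theorems.becSubharmonicContinuation_assembly_proof` (its module imports this route file, so no `_holds` link can be stated here).

/-! D-0027 §2.1 — DECIDING THEOREM (planner-authored via `route open/edit --closes-file`; by planner-rchoice-AtomisticToContinuum-BECSubhar-8d8792dd-0 2026-08-16T04:06:07Z):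
its hypotheses are this route's items and its conclusion the sub-problem Statement (glue_lint), and it elaborates with this file. -/

/-- DECIDING THEOREM (D-0027 §2.1, DEFINITION OF A ROUTE 2026-08-16: crux-only hypotheses). Pure logic: the shared crux
`PeriodicBEC` (stmt-AtomisticToContinuum-8997: constant-mode BEC for periodic near-minimisers at all small densities — the
node this route's line reaches through the support glue `ContinuationToPeriodicBEC : SubharmonicCoherence → HealingScaleDeficit →
PeriodicBEC` (main door) or `CoreContinuation : CoreSubharmonicCoherence → PeriodicBEC` (cell-free door), both by name) gives,
for every admissible `v`, the hypothesis of the shared crux `BoundaryTransferWeak` (stmt-AtomisticToContinuum-0827), which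
yields `HasGroundStateBEC v ρ` for all small `ρ`, i.e. the audited sub-problem statement `_root_.BoseEinsteinCondensation`
(abbrev of the Literature conjecture). No support, glue or target-derivation is assumed: when `ContinuationToPeriodicBEC_holds`
lands, a tenure edit may replace `hP` by `ContinuationToPeriodicBEC_holds h1 h2` over the cruxes S1, S2. -/
@[closes "route-AtomisticToContinuum-BECSubharmonicContinuation"] theorem closes (hP : PeriodicBEC) (hB : BoundaryTransferWeak) : _root_.BoseEinsteinCondensation :=
  fun v hv => hB v hv (hP v hv)

end Summit.AtomisticToContinuum.BoseEinsteinCondensation.Theses.BECSubharmonicContinuation
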